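import Summits.BirchSwinnertonDyer.BirchSwinnertonDyer.Theorems.ManinLocalTwoThreeManinPrimeToAdditiveFiveLeBistarredKodaira
import HarnessLib

/-!
# Route `ManinLocalTwoThree`, residual crux C5 `ManinPrimeToAdditiveFiveLe`
# (stmt-BirchSwinnertonDyer-22969), line `upper_anchor` (skeleton v8, stub `stub_optimalUnstarredNonGord57` = U):
# **the Manin-free optimality law U in KODAIRA SYMBOLS — «no lattice-optimal twist-minimal `W[p]`-reducible
# curve sits on the cells (5; IV*), (5; II*), (7; III*)»**

Width seat bsd-line-ml23-c5-p1-w2 (gen 3), piece λ5, sequel of `…BistarredKodaira` (p623276). The lead's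
skeleton v8 (gen 4) carries both `p ∈ {5,7}` corners of RED(57♯) — the «bi-starred orbit» corner (p621355)
and the «starred twin of the Kodaira-II cell at 5» corner (p622240) — by ONE Manin-free, degree-free law
U = `stub_optimalUnstarredNonGord57`: «a globally minimal `W` with a lattice-optimal conductor-level datum,
`p ∈ {5,7}`, `p² ∣ N(W) > 5·10⁵`, globally twist-minimal, `W[p]` reducible, no `Iₙ*` fibre at `p`, NOT
(G)-ordinary at `p`, has `ord_p Δ_min(W) ≤ 4`». By the unconditional dictionary of p623276 §1 (in-tree
Dokchitser–Dokchitser Thm. 3.2 on starred fibres) the ordinarity binder can be eliminated: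

* `optimalUnstarredNonGord57_of_kodairaCells`, `kodairaCells_of_optimalUnstarredNonGord57` — **U ⟺ K**,
  K := same binders WITHOUT `¬ TypeGOrd W p`, concluding
  `(p = 5 → ord_p Δ_min ≠ 8 ∧ ord_p Δ_min ≠ 10) ∧ (p = 7 → ord_p Δ_min ≠ 9)`: no such
  optimal curve is of Kodaira type IV* or II* at `5`, nor of type III* at `7` (the STARRED potentially
  supersingular cells, where the rational `p`-isogeny flips the type, [DokchitserDokchitser2015, Cor. 3.3]).
  K mentions neither the Manin constant nor ordinarity — a pure «which member is `X₀(N)`-optimal» statement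
  of Stein–Watkins type ([SteinWatkins2002]; Byeon–Kim, Acta Arith. 165 (2014), Remark on 33825be for the
  additive prime 5). Census (cell tables, `N ≤ 5·10⁵`): optimal `W[5]`-reducible curves are II 757 / IV 757 /
  III 377 / III* 377 — none IV*/II*; optimal `W[7]`-reducible: III 176 / IV* 112 / II 112 / II* 43 / IV 43 —
  none III*. 0 exceptions.

HONEST STATUS: an equivalence between two forms of an OPEN conjecture-shaped hypothesis (`--supports … --as
helper`); U and K are NOT asserted; nothing here proves BSD, Manin's conjecture or C5.

References: [DokchitserDokchitser2015LocalInvariants] Thm. 3.2, Cor. 3.3; [SilvermanATAEC1994] IV Table 4.1;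
[Stevens1989] §2; [EdixhovenManin1991] §4.
-/

set_option autoImplicit false
-- the Theorems namespace of this sub repeats the summit name by design (D-0017 nested layout)
set_option linter.dupNamespace false

noncomputable section

open scoped Classical NumberField

namespace Summit.BirchSwinnertonDyer.BirchSwinnertonDyer.Theorems

open WeierstrassCurve IsDedekindDomain IsDedekindDomain.HeightOneSpectrum Rat.HeightOneSpectrum NumberField
  Literature.NumberTheory.EllipticCurves Literature.NumberTheory.EllipticCurves.ModularForms
  Literature.NumberTheory.EllipticCurves.Rank1Residual
  Summit.BirchSwinnertonDyer.Rank1Residual.ManinAdditive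
  Summit.BirchSwinnertonDyer.Rank1Residual.Additive
  Summit.BirchSwinnertonDyer.BirchSwinnertonDyer.Theses.EdixhovenFibreFiveSeven

/-- **K ⟹ U**: if no lattice-optimal twist-minimal `W[p]`-reducible curve (`p² ∣ N > 5·10⁵`, no `Iₙ*`)
lies on the cells (5; IV*/II*), (7; III*), then every such curve which is NOT (G)-ordinary at `p` is
unstarred — because a starred one would be (5; III*) or (7; IV*/II*), which ARE (G)-ordinary
(`typeGOrd_iff_eq_nine_of_starred_five`, `typeGOrd_iff_ne_nine_of_starred_seven`). Unconditional
implication between hypotheses; neither side is asserted. [cite: DokchitserDokchitser2015LocalInvariants, Thm. 3.2] -/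
theorem optimalUnstarredNonGord57_of_kodairaCells
    (hK : exists_isNewformOf →
      ∀ (W : WeierstrassCurve ℚ) [W.IsElliptic] [W.IsGloballyMinimal] [NeZero (W.conductorNorm ℤ)]
        (D : ModularParametrizationData W (W.conductorNorm ℤ)),
        IsLatticeOptimal D → ∀ (p : ℕ) (hp : p.Prime), (p = 5 ∨ p = 7) → p ^ 2 ∣ W.conductorNorm ℤ →
        ¬ (∃ (W' : WeierstrassCurve ℚ) (q : ℕ), W'.IsElliptic ∧ W'.IsGloballyMinimal ∧ q.Prime ∧
            q ≠ 2 ∧ q ^ 2 ∣ W.conductorNorm ℤ ∧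
            IsIsogenous W (W'.quadraticTwist (((-1 : ℤ) ^ (q / 2) * q : ℤ) : ℚ)) ∧
            ¬ q ^ 2 ∣ W'.conductorNorm ℤ) →
        ¬ (∃ (W' : WeierstrassCurve ℚ) (d : ℤ), W'.IsElliptic ∧ W'.IsGloballyMinimal ∧
            (d = -1 ∨ d = 2 ∨ d = -2) ∧ 2 ^ 2 ∣ W.conductorNorm ℤ ∧
            IsIsogenous W (W'.quadraticTwist (d : ℚ)) ∧ ¬ 2 ^ 2 ∣ W'.conductorNorm ℤ) →
        ¬ W.HasIrreducibleModPGaloisRep p →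
        500000 < W.conductorNorm ℤ →
        (∀ n : ℕ, W.kodairaSymbolAt ((Rat.HeightOneSpectrum.primesEquiv (R := ℤ)).symm ⟨p, hp⟩) ≠
          .Istar n) →
        (p = 5 → padicValInt p W.minimalDiscriminantInt ≠ 8 ∧ padicValInt p W.minimalDiscriminantInt ≠ 10) ∧
          (p = 7 → padicValInt p W.minimalDiscriminantInt ≠ 9)) :
    exists_isNewformOf →
          ∀ (W : WeierstrassCurve ℚ) [W.IsElliptic] [W.IsGloballyMinimal] [NeZero (W.conductorNorm ℤ)]
            (D : ModularParametrizationData W (W.conductorNorm ℤ)),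
            IsLatticeOptimal D → ∀ (p : ℕ) (hp : p.Prime), (p = 5 ∨ p = 7) → p ^ 2 ∣ W.conductorNorm ℤ →
            ¬ (∃ (W' : WeierstrassCurve ℚ) (q : ℕ), W'.IsElliptic ∧ W'.IsGloballyMinimal ∧ q.Prime ∧
                q ≠ 2 ∧ q ^ 2 ∣ W.conductorNorm ℤ ∧
                IsIsogenous W (W'.quadraticTwist (((-1 : ℤ) ^ (q / 2) * q : ℤ) : ℚ)) ∧
                ¬ q ^ 2 ∣ W'.conductorNorm ℤ) →
            ¬ (∃ (W' : WeierstrassCurve ℚ) (d : ℤ), W'.IsElliptic ∧ W'.IsGloballyMinimal ∧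
                (d = -1 ∨ d = 2 ∨ d = -2) ∧ 2 ^ 2 ∣ W.conductorNorm ℤ ∧
                IsIsogenous W (W'.quadraticTwist (d : ℚ)) ∧ ¬ 2 ^ 2 ∣ W'.conductorNorm ℤ) →
            ¬ W.HasIrreducibleModPGaloisRep p →
            500000 < W.conductorNorm ℤ →
            (∀ n : ℕ, W.kodairaSymbolAt ((Rat.HeightOneSpectrum.primesEquiv (R := ℤ)).symm ⟨p, hp⟩) ≠
              .Istar n) →
            ¬ TypeGOrd W p →
            padicValInt p W.minimalDiscriminantInt ≤ 4 := by
  intro hnf W _ _ _ D hD p hp h57 hpN hodd hdy hred hN hI hG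
  haveI : Fact p.Prime := ⟨hp⟩
  have hadd : Addv W p := not_good_and_not_mult_of_sq_dvd_conductorNorm W hpN
  have hI' : ∀ n : ℕ, W.kodairaSymbolAt (placeOf p) ≠ .Istar n := hI
  by_contra hv
  push Not at hv
  obtain ⟨h5, h7⟩ := hK hnf W D hD p hp h57 hpN hodd hdy hred hN hI
  have hp5 : 5 ≤ p := by rcases h57 with rfl | rfl <;> norm_num
  obtain ⟨-, hmem⟩ := padicValRat_j_nonneg_and_mem_of_starred W p hp5 hadd hI' hv
  rcases h57 with hp5' | hp7'
  · obtain ⟨h8, h10⟩ := h5 hp5'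
    have h9 : padicValInt p W.minimalDiscriminantInt = 9 := by omega
    exact hG ((typeGOrd_iff_eq_nine_of_starred_five W p hp5' hadd hI' hv).mpr h9)
  · exact hG ((typeGOrd_iff_ne_nine_of_starred_seven W p hp7' hadd hI' hv).mpr (h7 hp7'))

/-- **U ⟹ K**: conversely, under U no such curve is of type IV*/II* at `5` or III* at `7` — those cells are
starred and NOT (G)-ordinary, so U would force `ord_p Δ_min ≤ 4` there. Hence U ⟺ K: the v8 stub in pure
Kodaira words. [cite: DokchitserDokchitser2015LocalInvariants, Thm. 3.2] -/
theorem kodairaCells_of_optimalUnstarredNonGord57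
    (hU : exists_isNewformOf →
      ∀ (W : WeierstrassCurve ℚ) [W.IsElliptic] [W.IsGloballyMinimal] [NeZero (W.conductorNorm ℤ)]
        (D : ModularParametrizationData W (W.conductorNorm ℤ)),
        IsLatticeOptimal D → ∀ (p : ℕ) (hp : p.Prime), (p = 5 ∨ p = 7) → p ^ 2 ∣ W.conductorNorm ℤ →
        ¬ (∃ (W' : WeierstrassCurve ℚ) (q : ℕ), W'.IsElliptic ∧ W'.IsGloballyMinimal ∧ q.Prime ∧
            q ≠ 2 ∧ q ^ 2 ∣ W.conductorNorm ℤ ∧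
            IsIsogenous W (W'.quadraticTwist (((-1 : ℤ) ^ (q / 2) * q : ℤ) : ℚ)) ∧
            ¬ q ^ 2 ∣ W'.conductorNorm ℤ) →
        ¬ (∃ (W' : WeierstrassCurve ℚ) (d : ℤ), W'.IsElliptic ∧ W'.IsGloballyMinimal ∧
            (d = -1 ∨ d = 2 ∨ d = -2) ∧ 2 ^ 2 ∣ W.conductorNorm ℤ ∧
            IsIsogenous W (W'.quadraticTwist (d : ℚ)) ∧ ¬ 2 ^ 2 ∣ W'.conductorNorm ℤ) →
        ¬ W.HasIrreducibleModPGaloisRep p →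
        500000 < W.conductorNorm ℤ →
        (∀ n : ℕ, W.kodairaSymbolAt ((Rat.HeightOneSpectrum.primesEquiv (R := ℤ)).symm ⟨p, hp⟩) ≠
          .Istar n) →
        ¬ TypeGOrd W p →
        padicValInt p W.minimalDiscriminantInt ≤ 4) :
    exists_isNewformOf →
          ∀ (W : WeierstrassCurve ℚ) [W.IsElliptic] [W.IsGloballyMinimal] [NeZero (W.conductorNorm ℤ)]
            (D : ModularParametrizationData W (W.conductorNorm ℤ)),
            IsLatticeOptimal D → ∀ (p : ℕ) (hp : p.Prime), (p = 5 ∨ p = 7) → p ^ 2 ∣ W.conductorNorm ℤ →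
            ¬ (∃ (W' : WeierstrassCurve ℚ) (q : ℕ), W'.IsElliptic ∧ W'.IsGloballyMinimal ∧ q.Prime ∧
                q ≠ 2 ∧ q ^ 2 ∣ W.conductorNorm ℤ ∧
                IsIsogenous W (W'.quadraticTwist (((-1 : ℤ) ^ (q / 2) * q : ℤ) : ℚ)) ∧
                ¬ q ^ 2 ∣ W'.conductorNorm ℤ) →
            ¬ (∃ (W' : WeierstrassCurve ℚ) (d : ℤ), W'.IsElliptic ∧ W'.IsGloballyMinimal ∧
                (d = -1 ∨ d = 2 ∨ d = -2) ∧ 2 ^ 2 ∣ W.conductorNorm ℤ ∧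
                IsIsogenous W (W'.quadraticTwist (d : ℚ)) ∧ ¬ 2 ^ 2 ∣ W'.conductorNorm ℤ) →
            ¬ W.HasIrreducibleModPGaloisRep p →
            500000 < W.conductorNorm ℤ →
            (∀ n : ℕ, W.kodairaSymbolAt ((Rat.HeightOneSpectrum.primesEquiv (R := ℤ)).symm ⟨p, hp⟩) ≠
              .Istar n) →
            (p = 5 → padicValInt p W.minimalDiscriminantInt ≠ 8 ∧ padicValInt p W.minimalDiscriminantInt ≠ 10) ∧
              (p = 7 → padicValInt p W.minimalDiscriminantInt ≠ 9) := by
  intro hnf W _ _ _ D hD p hp h57 hpN hodd hdy hred hN hI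
  haveI : Fact p.Prime := ⟨hp⟩
  have hadd : Addv W p := not_good_and_not_mult_of_sq_dvd_conductorNorm W hpN
  have hI' : ∀ n : ℕ, W.kodairaSymbolAt (placeOf p) ≠ .Istar n := hI
  have key : 4 < padicValInt p W.minimalDiscriminantInt → ¬ TypeGOrd W p → False := fun hv hG ↦ by
    have := hU hnf W D hD p hp h57 hpN hodd hdy hred hN hI hG
    omega
  refine ⟨fun hp5' ↦ ⟨fun h8 ↦ ?_, fun h10 ↦ ?_⟩, fun hp7' h9 ↦ ?_⟩
  · have hv : 4 < padicValInt p W.minimalDiscriminantInt := by omega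
    exact key hv fun hG ↦ by
      have := (typeGOrd_iff_eq_nine_of_starred_five W p hp5' hadd hI' hv).mp hG; omega
  · have hv : 4 < padicValInt p W.minimalDiscriminantInt := by omega
    exact key hv fun hG ↦ by
      have := (typeGOrd_iff_eq_nine_of_starred_five W p hp5' hadd hI' hv).mp hG; omega
  · have hv : 4 < padicValInt p W.minimalDiscriminantInt := by omega
    exact key hv fun hG ↦ (typeGOrd_iff_ne_nine_of_starred_seven W p hp7' hadd hI' hv).mp hG h9

end Summit.BirchSwinnertonDyer.BirchSwinnertonDyer.Theorems

end
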